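import Summits.AtomisticToContinuum.BoseEinsteinCondensation.Theses.BECEqualScatteringTransfer
import Summits.AtomisticToContinuum.BoseEinsteinCondensation.Theses.BECChargeConjugationRP

/-!
# Crux `RepresentativeBEC` (stmt-AtomisticToContinuum-12538) — birth skeleton (BC3), line `birth-torustwin`

Route of record: `route-AtomisticToContinuum-BECEqualScatteringTransfer` (the crux is X_R of its thesis
X = X_T ∧ X_R). The crux: for every real `a ≥ 0` SOME bounded admissible (measurable, finite-range,
repulsive) radial profile `v` with `scatteringLength v = ofReal a` — the prover's choice of representative —
has Dirichlet ground-state BEC at all small densities (`∃ ρ₀ > 0, ∀ ρ ∈ (0, ρ₀), HasGroundStateBEC v ρ`).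

## The cut (two registered stubs, both load-bearing): TORUS TWIN + BOUNDARY TRANSFER

The route's own two-layer plan reads "RepresentativeBEC ⇐ BEC for the chosen family — another route's
crux restricted to the family (CornerTransfer of BECChargeConjugationRP, … ) + BoundaryTransferWeak
stmt-0827". Every method line that can produce condensation for an interacting dilute gas works on the
TORUS (momentum conservation: the condensate wave function IS the constant mode, no healing-length wall
layer; Bogoliubov theory, the second-order energy expansions, Fournais 2020 Thm 1.2 and LSSY 2005 Thm 5.1
are periodic/Neumann statements; reflection positivity and Gaussian domination need periodic b.c.), and
the passage torus → Dirichlet box is one named, shared, independently staffed hinge. So the crux is cut as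

* `stub_representativePeriodicBEC : RepresentativePeriodicBEC` (NEW; the hard stub): the TORUS TWIN of
  the crux — for every `a ≥ 0` some bounded admissible `v` with `scatteringLength v = ofReal a` satisfies
  `PeriodicBEC(v)` (the body of stmt-AtomisticToContinuum-0826 at `v`: for all small `ρ` there is `c > 0`
  such that, eventually in `N`, for some `δ > 0` every periodic trial state on the torus of side
  `(N/ρ)^{1/3}` within `δ` of the periodic ground-state energy has constant-mode occupation `≥ cN`).
  Prover's choice of representative per `a`, exactly as in the crux. Sufficient conditions PROVED below:
  the Born-window torus BEC `BornWindowPeriodicBEC` (= VERBATIM the consequent of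
  `Theses.BECChargeConjugationRP.CornerTransfer`, stmt-9047, which has its own registered skeleton
  `Cruxes/CornerTransfer/Lines/birth.lean`) implies it through the landed `BornRepresentativesExist_holds`
  (`representativePeriodicBEC_of_bornWindow`), hence so do `RelCornerLRO ∧ CornerTransfer` of the
  reflection-positivity route (`representativePeriodicBEC_of_cornerTransfer`); `PeriodicBEC` (∀ v,
  stmt-0826-shaped decls of ~12 routes) implies it a fortiori.
* `stub_boundaryTransferWeak : Theses.BECChargeConjugationRP.BoundaryTransferWeak`, the shared hinge
  item stmt-AtomisticToContinuum-0827 BY NAME (one proposition under ~40 route names; live crux chain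
  under `Cruxes/BoundaryTransferWeak/` with registered lines `birth-slackexchange`,
  `coupled_baths_certified`, `mode_free_reward`, `mode_free_reward_split`), so closing 0827 closes this
  stub: per potential, torus BEC of the periodic near-minimisers at all small densities ⟹ Dirichlet
  ground-state BEC (`HasGroundStateBEC`, i.e. `λ_max ≥ cN` via `condensateNumber`) at all small densities.

Neither stub gives the crux or the conjunct cheaply (BC3 probes in the seat folder `bc/`, all rc 1):
stub 1 lives on the torus and never mentions `HasGroundStateBEC`; stub 2 is an implication whose
antecedent is open for every `v ≠ 0`.

## The composition (sorry-free)

`representativeBEC_from` (stub statements → the crux UNFOLDED, so that the parametric theorem is not a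
by-name candidate of the skeleton audit): given `a ≥ 0`, stub 1 hands a bounded admissible `v` with
`scatteringLength v = ofReal a` and `PeriodicBEC(v)`; stub 2 at `v` turns the latter into Dirichlet
small-density BEC. `RepresentativeBEC_of` (= `representativeBEC_from stub_representativePeriodicBEC
stub_boundaryTransferWeak`) concludes the route decl `Theses.BECEqualScatteringTransfer.RepresentativeBEC`
BY NAME; direct `sorry` only inside the two `stub_*`.

References: LSSY 2005 §1.2 (1.17)–(1.19), Ch. 2 after (2.8), Ch. 5 (5.1)–(5.2), App. C Thm C.1;
Fournais 2020 (arXiv:2011.00309) Thm 1.2; Junge 2026 (arXiv:2603.20776) Cor. 6; Robinson 1976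
(doi:10.1007/bf01608554); Seiringer 2011 (doi:10.1007/s00220-011-1261-6).
-/

noncomputable section

open Filter
open scoped ENNReal NNReal

namespace Summit.AtomisticToContinuum.BoseEinsteinCondensation.Cruxes.RepresentativeBEC.BirthTorusTwin

open Literature.MathematicalPhysics.QuantumManyBody.BoseGas

/-! ## Registered stubs -/

/-- **Stub 1 statement — the torus twin of the crux (representative periodic BEC).** For every real
`a ≥ 0` there is a bounded admissible radial profile `v` with `scatteringLength v = ofReal a` such that
`PeriodicBEC(v)` holds: there is `ρ₀ > 0` such that for `0 < ρ < ρ₀` there is `c > 0` with, eventually in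
`N`, some `δ > 0` for which every periodic trial state `Ψ` on the torus of side `(N/ρ)^{1/3}` with
`periodicEnergy v Ψ ≤ E₀^per(N, L) + δ` has constant-mode occupation `condensateOccupation ≥ cN`
(body of stmt-0826 at `v`, verbatim). Plausible because it is the periodic BEC conjecture for ONE bounded
potential per scattering length, prover's choice (square well, Born-soft top hat, positive-type bump, …;
`a = 0 ↦ v = 0`, the free torus gas); hard because it is thermodynamic-limit BEC for an interacting 3-D
gas (rigorous torus/Neumann BEC reaches side lengths `~ a(ρa³)^{-3/4-η}` only, Junge 2026 Cor. 6;
Fournais 2020 Thm 1.2). Size XL / open-problem rank. [cite: LSSY2005, Ch. 5 (5.1)–(5.2)] -/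
def RepresentativePeriodicBEC : Prop :=
  ∀ a : ℝ, 0 ≤ a → ∃ v : ℝ → ℝ≥0∞, IsRepulsiveFiniteRange v ∧ (∃ M : NNReal, ∀ r, v r ≤ M) ∧
    scatteringLength v = ENNReal.ofReal a ∧
    ∃ ρ₀ : ℝ, 0 < ρ₀ ∧ ∀ ρ : ℝ, 0 < ρ → ρ < ρ₀ → ∃ c : ℝ, 0 < c ∧ ∀ᶠ N : ℕ in Filter.atTop,
      ∃ δ : ENNReal, 0 < δ ∧ ∀ Ψ : PeriodicTrialState N (sideLength ρ N),
        periodicEnergy v Ψ ≤ periodicGroundStateEnergy v N (sideLength ρ N) + δ →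
          ENNReal.ofReal (c * N) ≤ condensateOccupation N (sideLength ρ N) Ψ.ψ

/-- **Registered stub 1**: the torus twin `RepresentativePeriodicBEC` (docstring above). -/
theorem stub_representativePeriodicBEC : RepresentativePeriodicBEC := by
  sorry

/-- **Registered stub 2** — the shared boundary-condition transfer stmt-AtomisticToContinuum-0827 BY NAME
(`Theses.BECChargeConjugationRP.BoundaryTransferWeak`): for each admissible `v`, torus BEC of the periodic
near-minimisers at all small densities implies Dirichlet ground-state BEC at all small densities. Size XL
(only the ENERGY is known to be boundary-condition independent, LSSY 2005 Ch. 2 after (2.8); live lines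
under `Cruxes/BoundaryTransferWeak/Lines/`). -/
theorem stub_boundaryTransferWeak : Theses.BECChargeConjugationRP.BoundaryTransferWeak := by
  sorry

/-! ## Proved sufficient conditions for stub 1 (feeders; not stubs) -/

/-- **Born-window torus BEC** — verbatim the consequent of `Theses.BECChargeConjugationRP.CornerTransfer`
(stmt-9047): for SOME coupling `ε₀ > 0`, every admissible `v` with a range `R > 0` inside the Born window
`v ≤ ε₀/R²` satisfies `PeriodicBEC(v)`. The weak-coupling (kinetic-energy dominated) family is the small
parameter of the RG / cluster / lattice lines. [cite: LSSY2005, Ch. 2 after (2.13)] -/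
def BornWindowPeriodicBEC : Prop :=
  ∃ ε₀ : ℝ, 0 < ε₀ ∧ ∀ v : ℝ → ℝ≥0∞, IsRepulsiveFiniteRange v →
    (∃ R : ℝ, 0 < R ∧ (∀ r, R < r → v r = 0) ∧ ∀ r, v r ≤ ENNReal.ofReal (ε₀ / R ^ 2)) →
    ∃ ρ₀ : ℝ, 0 < ρ₀ ∧ ∀ ρ : ℝ, 0 < ρ → ρ < ρ₀ → ∃ c : ℝ, 0 < c ∧ ∀ᶠ N : ℕ in Filter.atTop,
      ∃ δ : ENNReal, 0 < δ ∧ ∀ Ψ : PeriodicTrialState N (sideLength ρ N),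
        periodicEnergy v Ψ ≤ periodicGroundStateEnergy v N (sideLength ρ N) + δ →
          ENNReal.ofReal (c * N) ≤ condensateOccupation N (sideLength ρ N) Ψ.ψ

/-- Born-window torus BEC implies the torus twin: the Born representative of `a` at the coupling `ε₀`
(landed `BornRepresentativesExist_holds`, item stmt-9049: top hat of height `ε₀/R²`,
`a = R(1 - tanh Y/Y)`, `Y = √(ε₀/2)`) is bounded, admissible, has `scatteringLength = ofReal a` and lies
in the window. [folklore] -/
theorem representativePeriodicBEC_of_bornWindow (h : BornWindowPeriodicBEC) :
    RepresentativePeriodicBEC := by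
  intro a ha
  obtain ⟨ε₀, hε₀, hP⟩ := h
  obtain ⟨v, hv, hM, ⟨R, hR, hvan, hborn⟩, hsc⟩ :=
    Theses.BECEqualScatteringTransfer.BornRepresentativesExist_holds ε₀ hε₀ a ha
  exact ⟨v, hv, hM, hsc, hP v hv ⟨R, hR, hvan, hborn⟩⟩

/-- Composability with the reflection-positivity route `BECChargeConjugationRP`: its cruxes
`RelCornerLRO` (stmt-9046 class) and `CornerTransfer` (stmt-9047, own registered skeleton) give the torus
twin, since the consequent of `CornerTransfer` is literally `BornWindowPeriodicBEC`. [folklore] -/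
theorem representativePeriodicBEC_of_cornerTransfer (hT : Theses.BECChargeConjugationRP.CornerTransfer)
    (hR : Theses.BECChargeConjugationRP.RelCornerLRO) : RepresentativePeriodicBEC :=
  representativePeriodicBEC_of_bornWindow (hT hR)

/-! ## Glue (proved) -/

/-- **The two stub statements imply the crux** (kernel-checked, no `sorry`; the conclusion is the crux
UNFOLDED so that this parametric theorem is not itself a by-name candidate of the skeleton audit): the
representative of stub 1 condenses on the torus, hence, by stub 2 at that potential, in the Dirichlet box
at all small densities. [folklore] -/
theorem representativeBEC_from (h1 : RepresentativePeriodicBEC)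
    (h2 : Theses.BECChargeConjugationRP.BoundaryTransferWeak) :
    ∀ a : ℝ, 0 ≤ a → ∃ v : ℝ → ℝ≥0∞, IsRepulsiveFiniteRange v ∧ (∃ M : NNReal, ∀ r, v r ≤ M) ∧
      scatteringLength v = ENNReal.ofReal a ∧
      ∃ ρ₀ : ℝ, 0 < ρ₀ ∧ ∀ ρ : ℝ, 0 < ρ → ρ < ρ₀ → HasGroundStateBEC v ρ := by
  intro a ha
  obtain ⟨v, hv, hM, hsc, hP⟩ := h1 a ha
  exact ⟨v, hv, hM, hsc, h2 v hv hP⟩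

/-! ## The composition: the crux BY NAME from the two stubs -/

/-- **`RepresentativeBEC` (the route decl, BY NAME) from the two REGISTERED STUBS** — the skeleton
theorem: `representativeBEC_from stub_representativePeriodicBEC stub_boundaryTransferWeak`. Its only
non-whitelisted axiom is the `sorryAx` of the two stubs; it closes the crux the day both are theorems.
[folklore] -/
theorem RepresentativeBEC_of : Theses.BECEqualScatteringTransfer.RepresentativeBEC :=
  representativeBEC_from stub_representativePeriodicBEC stub_boundaryTransferWeak

end Summit.AtomisticToContinuum.BoseEinsteinCondensation.Cruxes.RepresentativeBEC.BirthTorusTwin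

end
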